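import Mathlib

/-!
# SoloBlind — chain coefficient monotonicity (statement-layer glue of LEMMA P, regime (II))

Elementary order facts that the certified engine (engineL v1.2l+/gtaylor, tail seed of kernel
`SoloBlindTailOperator`) uses when it bounds ALL tail rows `k ≥ K` of the two three-term chains by
the single row `K`:

* the streak coefficients `a_k ∈ {1, (k-1)/k}` are at most `1` and increase with `k`;
* the roll coefficients `c_k ∈ {1, (k+3)/(k+2)}` exceed `1` and DECREASE with `k`, hence
  `sup_{k ≥ K} c_k = c_K`;
* the diagonal entries `β_k = A + i (B + γ (k² - K²))` (`γ = g⁴ ≥ 0`, real part independent of `k`)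
  have `|β_k| ≥ |β_K|` for every `k ≥ K` as soon as `B = Im β_K ≥ 0`.

All statements are over `ℝ` / `ℂ` with explicit hypotheses; no analysis beyond `Mathlib` order lemmas.
-/

namespace Summit.AnomalousDissipation.SoloBlind.ChainMonotone

/-- The streak coefficient `(k-1)/k` is at most `1` for every real `k > 0`. -/
theorem streak_coeff_le_one {k : ℝ} (hk : 0 < k) : (k - 1) / k ≤ 1 := by
  rw [div_le_one hk]; linarith

/-- The streak coefficient `(k-1)/k` is nonnegative for `k ≥ 1`. -/
theorem streak_coeff_nonneg {k : ℝ} (hk : 1 ≤ k) : 0 ≤ (k - 1) / k :=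
  div_nonneg (by linarith) (by linarith)

/-- The streak coefficients increase with the index: `(k-1)/k ≤ (k'-1)/k'` for `0 < k ≤ k'`. -/
theorem streak_coeff_mono {k k' : ℝ} (hk : 0 < k) (hkk' : k ≤ k') :
    (k - 1) / k ≤ (k' - 1) / k' := by
  have hk' : 0 < k' := lt_of_lt_of_le hk hkk'
  rw [div_le_div_iff₀ hk hk']
  nlinarith

/-- The roll coefficient `(k+3)/(k+2)` exceeds `1` for every real `k > -2`. -/
theorem one_lt_roll_coeff {k : ℝ} (hk : -2 < k) : 1 < (k + 3) / (k + 2) := by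
  rw [one_lt_div (by linarith)]; linarith

/-- The roll coefficients DECREASE with the index: `(k'+3)/(k'+2) ≤ (k+3)/(k+2)` for `-2 < k ≤ k'`. -/
theorem roll_coeff_anti {k k' : ℝ} (hk : -2 < k) (hkk' : k ≤ k') :
    (k' + 3) / (k' + 2) ≤ (k + 3) / (k + 2) := by
  have h2 : 0 < k + 2 := by linarith
  have h2' : 0 < k' + 2 := by linarith
  rw [div_le_div_iff₀ h2' h2]
  nlinarith

/-- Consequently the supremum of the roll coefficients over a tail `k ≥ K` is attained at `K`:
every `c_k` with `k ≥ K > -2` is bounded by `c_K` (the engine's `cmax := c_K`). -/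
theorem roll_coeff_le_head {K k : ℝ} (hK : -2 < K) (hk : K ≤ k) :
    (k + 3) / (k + 2) ≤ (K + 3) / (K + 2) :=
  roll_coeff_anti hK hk

/-- The imaginary part of the tail diagonal, `B + γ (k² - K²)`, is monotone in `k` on `k ≥ K ≥ 0`
when `γ ≥ 0`. -/
theorem im_diag_mono {B γ K k k' : ℝ} (hγ : 0 ≤ γ) (hK : 0 ≤ K) (hk : K ≤ k) (hkk' : k ≤ k') :
    B + γ * (k ^ 2 - K ^ 2) ≤ B + γ * (k' ^ 2 - K ^ 2) := by
  have : k ^ 2 ≤ k' ^ 2 := by nlinarith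
  nlinarith

/-- In particular it stays above its value `B` at the head row `K`. -/
theorem im_diag_ge_head {B γ K k : ℝ} (hγ : 0 ≤ γ) (hK : 0 ≤ K) (hk : K ≤ k) :
    B ≤ B + γ * (k ^ 2 - K ^ 2) := by
  have : K ^ 2 ≤ k ^ 2 := by nlinarith
  nlinarith

/-- Modulus comparison of two complex numbers with the same real part and ordered NONNEGATIVE
imaginary parts: `|A + iB| ≤ |A + iB'|` for `0 ≤ B ≤ B'`. -/
theorem norm_le_norm_of_im_le {A B B' : ℝ} (hB : 0 ≤ B) (hBB' : B ≤ B') :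
    ‖(⟨A, B⟩ : ℂ)‖ ≤ ‖(⟨A, B'⟩ : ℂ)‖ := by
  have h1 : ‖(⟨A, B⟩ : ℂ)‖ = Real.sqrt (A * A + B * B) := by
    rw [Complex.norm_def]; rfl
  have h2 : ‖(⟨A, B'⟩ : ℂ)‖ = Real.sqrt (A * A + B' * B') := by
    rw [Complex.norm_def]; rfl
  rw [h1, h2]
  apply Real.sqrt_le_sqrt
  nlinarith

/-- THE TAIL-ROW DOMINATION used by the engine's tail seed: with `β_k := A + i (B + γ (k² - K²))`,
`γ ≥ 0`, `K ≥ 0` and `B = Im β_K ≥ 0`, every deeper row has `|β_k| ≥ |β_K|` (`k ≥ K`). -/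
theorem norm_diag_ge_head {A B γ K k : ℝ} (hγ : 0 ≤ γ) (hK : 0 ≤ K) (hB : 0 ≤ B) (hk : K ≤ k) :
    ‖(⟨A, B⟩ : ℂ)‖ ≤ ‖(⟨A, B + γ * (k ^ 2 - K ^ 2)⟩ : ℂ)‖ :=
  norm_le_norm_of_im_le hB (im_diag_ge_head hγ hK hk)

/-- … and the domination is itself monotone along the tail (`K ≤ k ≤ k'`). -/
theorem norm_diag_mono {A B γ K k k' : ℝ} (hγ : 0 ≤ γ) (hK : 0 ≤ K) (hB : 0 ≤ B) (hk : K ≤ k)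
    (hkk' : k ≤ k') :
    ‖(⟨A, B + γ * (k ^ 2 - K ^ 2)⟩ : ℂ)‖ ≤ ‖(⟨A, B + γ * (k' ^ 2 - K ^ 2)⟩ : ℂ)‖ :=
  norm_le_norm_of_im_le (le_trans hB (im_diag_ge_head hγ hK hk)) (im_diag_mono hγ hK hk hkk')

end Summit.AnomalousDissipation.SoloBlind.ChainMonotone
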